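import Summits.ValiantsHypothesis.ValiantsHypothesis.Theorems.LacunarySymmetroidMatrixDescartesCensusEdgeZeroNine

/-!
# `MatrixDescartes` census — W4: THEOREM O9 in the kernel — the edge `0..9` is dead on all ten core triples

HONEST FRAMING.  Object-search cell `pub-symmetroid`, item `DoorA26 = PosRootLawAt 2 6 19` (stmt-ValiantsHypothesis-19979,
OPEN, typed, never asserted).  W4 line (engine-1 g17–g22).  Companion of `…CensusEdgeZeroNine` (the square-root-free
split): here the ten CERTIFICATES.  For each of the ten exponent triples `(d₁,d₂,d₃) − d₀ ∈ {(2,3,7), (2,3,8), (2,3,9),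
(2,3,10), (2,3,11), (3,4,9), (3,4,10), (3,4,11), (3,5,11), (4,5,11)}` that occur as the first four exponents of the
230 chamber-1706/954 core supports (seat note CAPACITY09-E1G18 §3; the mirror edge `11..20` on chamber 954 uses the
same triples read from the top), the 10-term hull-edge form of the pure channel-9 faces
`F = q₀ + b₁X^{d₁} + b₂X^{d₂} + b₃X^{d₃} − (y₁X^{d₁} + y₂X^{d₂} + y₃X^{d₃})²` (`y₁y₂ < 0 < y₁y₃`; the free letters
`q₀, b₁, b₂, b₃` need NO sign) has at most `8 < 9 = #terms − 1` positive roots COUNTED WITH MULTIPLICITY: four Euler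
twists, then the residual quadratic form `Σ m(d_i+d_j)y_iy_jX^{d_i+d_j}` is split as `Yᵀ(P − uuᵀ)Y` with an INTEGER
vector `u` and a rational `LDLᵀ` certificate of `P ⪰ 0`, and the seven sign conditions of the split lemma are checked
by `norm_num` (nine triples); for `(4,5,11)` no such `u` exists (the sign conditions are linear in `u` and
contradictory), and one more Euler twist at the REAL weight `17/2` (the tree's real-weight twisted Rolle) is taken
first, after which `u = (0, 36, −3450)` works with `p` a binomial of one sign (no positive root), giving `≤ 7`.
So every face of `C₇` containing the elbow `9` is now dead IN THE KERNEL on every core support (with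
`…CensusEdgeThreeNine/TwoNine/OneNine` for the faces that also contain `1`, `2` or `3`).  The seat's chamber-uniform
analytic THEOREM O9 (`≤ 7` for all `d₂ < 2d₁`, `2d₂ < d₃`) is not typed here.  Certificates: engine-1 g22,
`work/o9/gen_cert.py` (exact).  Nothing here bounds `ζ_sym(2,6)`, decides `DoorA26`, or bears on the crux
`MatrixDescartes` (stmt-ValiantsHypothesis-18050) / `VP ≠ VNP`: a dead channel is a statement about hypothetical objects.

[folklore] Rolle with multiplicity + Descartes' bound by sign blocks, with explicit rational certificates; no single source.
-/

-- `Summit.ValiantsHypothesis.ValiantsHypothesis.…` repeats a component by the D-0017 layout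
-- (single-conjunct summit), which the `dupNamespace` linter flags; the name is mandated.
set_option linter.dupNamespace false

namespace Summit.ValiantsHypothesis.ValiantsHypothesis.Theorems.LacunarySymmetroidMatrixDescartes.Census

open Polynomial Finset
open scoped BigOperators Polynomial

/-! ### One more Euler twist of a 6-nomial, at a real weight -/

/-- The Euler twist `X·S′ − μ·S` of an explicit 6-nomial multiplies the coefficient at `X^n` by `n − μ`. [folklore] -/
theorem twist_sixnomial (n₁ n₂ n₃ n₄ n₅ n₆ : ℕ) (g₁ g₂ g₃ g₄ g₅ g₆ μ : ℝ) :
    X * derivative (C g₁ * X ^ n₁ + C g₂ * X ^ n₂ + C g₃ * X ^ n₃ + C g₄ * X ^ n₄ + C g₅ * X ^ n₅ + C g₆ * X ^ n₆ : ℝ[X])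
        - C μ * (C g₁ * X ^ n₁ + C g₂ * X ^ n₂ + C g₃ * X ^ n₃ + C g₄ * X ^ n₄ + C g₅ * X ^ n₅ + C g₆ * X ^ n₆)
      = C (g₁ * ((n₁ : ℝ) - μ)) * X ^ n₁ + C (g₂ * ((n₂ : ℝ) - μ)) * X ^ n₂ + C (g₃ * ((n₃ : ℝ) - μ)) * X ^ n₃
        + C (g₄ * ((n₄ : ℝ) - μ)) * X ^ n₄ + C (g₅ * ((n₅ : ℝ) - μ)) * X ^ n₅ + C (g₆ * ((n₆ : ℝ) - μ)) * X ^ n₆ := by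
  have e1 := Literature.Analysis.FluidPDE.Elgindi.X_mul_derivative_X_pow n₁
  have e2 := Literature.Analysis.FluidPDE.Elgindi.X_mul_derivative_X_pow n₂
  have e3 := Literature.Analysis.FluidPDE.Elgindi.X_mul_derivative_X_pow n₃
  have e4 := Literature.Analysis.FluidPDE.Elgindi.X_mul_derivative_X_pow n₄
  have e5 := Literature.Analysis.FluidPDE.Elgindi.X_mul_derivative_X_pow n₅
  have e6 := Literature.Analysis.FluidPDE.Elgindi.X_mul_derivative_X_pow n₆
  have hS : X * derivative (C g₁ * X ^ n₁ + C g₂ * X ^ n₂ + C g₃ * X ^ n₃ + C g₄ * X ^ n₄ + C g₅ * X ^ n₅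
        + C g₆ * X ^ n₆ : ℝ[X])
      = C g₁ * (C (n₁ : ℝ) * X ^ n₁) + C g₂ * (C (n₂ : ℝ) * X ^ n₂) + C g₃ * (C (n₃ : ℝ) * X ^ n₃)
        + C g₄ * (C (n₄ : ℝ) * X ^ n₄) + C g₅ * (C (n₅ : ℝ) * X ^ n₅) + C g₆ * (C (n₆ : ℝ) * X ^ n₆) := by
    rw [← e1, ← e2, ← e3, ← e4, ← e5, ← e6]; simp only [derivative_add, derivative_C_mul]; ring
  rw [hS]
  simp only [map_mul, map_sub]
  ring


/-- **SPLIT LEMMA, coarse form**: under the hypotheses of `countP_posRoots_quadform_le`, `#Z₊^{mult}(G) ≤ 4`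
(`p` is a trinomial). [folklore] -/
theorem countP_posRoots_quadform_le_four (d₁ d₂ d₃ : ℕ) (h₁ : d₁ < d₂) (h₂ : d₂ < d₃) (h₃ : 2 * d₂ < d₁ + d₃)
    (y₁ y₂ y₃ : ℝ) (hy₁ : 0 < y₁) (hy₂ : y₂ < 0) (hy₃ : 0 < y₃)
    (A₁₁ A₁₂ A₂₂ A₁₃ A₂₃ A₃₃ u₁ u₂ u₃ a b₁ b₂ c e f : ℝ) (ha : 0 ≤ a) (hc : 0 ≤ c) (hf : 0 < f)
    (hP₁₁ : A₁₁ + u₁ ^ 2 = a) (hP₁₂ : A₁₂ + u₁ * u₂ = a * b₁) (hP₁₃ : A₁₃ + u₁ * u₃ = a * b₂)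
    (hP₂₂ : A₂₂ + u₂ ^ 2 = a * b₁ ^ 2 + c) (hP₂₃ : A₂₃ + u₂ * u₃ = a * b₁ * b₂ + c * e)
    (hP₃₃ : A₃₃ + u₃ ^ 2 = a * b₂ ^ 2 + c * e ^ 2 + f)
    (hk₁ : u₁ * (A₁₂ + u₁ * u₂) - u₂ * (A₁₁ + u₁ ^ 2) ≤ 0)
    (hk₂ : 0 ≤ u₁ * (A₂₂ + u₂ ^ 2) - u₂ * (A₁₂ + u₁ * u₂))
    (hk₃ : 0 ≤ u₁ * (A₁₃ + u₁ * u₃) - u₃ * (A₁₁ + u₁ ^ 2))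
    (hk₄ : u₁ * (A₂₃ + u₂ * u₃) * ((d₂ : ℝ) + d₃ - 2 * d₁) + u₂ * (A₁₃ + u₁ * u₃) * ((d₁ : ℝ) + d₃ - 2 * d₂)
        + u₃ * (A₁₂ + u₁ * u₂) * ((d₁ : ℝ) + d₂ - 2 * d₃) ≤ 0)
    (hk₅ : 0 ≤ u₂ * (A₂₃ + u₂ * u₃) - u₃ * (A₂₂ + u₂ ^ 2))
    (hk₆ : 0 ≤ u₁ * (A₃₃ + u₃ ^ 2) - u₃ * (A₁₃ + u₁ * u₃))
    (hk₇ : 0 < u₂ * (A₃₃ + u₃ ^ 2) - u₃ * (A₂₃ + u₂ * u₃)) :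
    ((C (A₁₁ * y₁ ^ 2) * X ^ (2 * d₁) + C (2 * A₁₂ * y₁ * y₂) * X ^ (d₁ + d₂) + C (A₂₂ * y₂ ^ 2) * X ^ (2 * d₂)
        + C (2 * A₁₃ * y₁ * y₃) * X ^ (d₁ + d₃) + C (2 * A₂₃ * y₂ * y₃) * X ^ (d₂ + d₃)
        + C (A₃₃ * y₃ ^ 2) * X ^ (2 * d₃) : ℝ[X]).roots.countP (fun x => 0 < x)) ≤ 4 := by
  have main := countP_posRoots_quadform_le d₁ d₂ d₃ h₁ h₂ h₃ y₁ y₂ y₃ hy₁ hy₂ hy₃ A₁₁ A₁₂ A₂₂ A₁₃ A₂₃ A₃₃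
    u₁ u₂ u₃ a b₁ b₂ c e f ha hc hf hP₁₁ hP₁₂ hP₁₃ hP₂₂ hP₂₃ hP₃₃ hk₁ hk₂ hk₃ hk₄ hk₅ hk₆ hk₇
  -- the trinomial `p` has at most two positive roots (fewer roots than monomials)
  have hZp : ((C (u₁ * y₁) * X ^ d₁ + C (u₂ * y₂) * X ^ d₂ + C (u₃ * y₃) * X ^ d₃ : ℝ[X]).roots.countP
      (fun x => 0 < x)) ≤ 2 := by
    rcases eq_or_ne (C (u₁ * y₁) * X ^ d₁ + C (u₂ * y₂) * X ^ d₂ + C (u₃ * y₃) * X ^ d₃ : ℝ[X]) 0 with hp | hp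
    · rw [hp, roots_zero]; simp
    · have h1 := countP_posRoots_lt_card_support hp
      have h3 : (C (u₁ * y₁) * X ^ d₁ + C (u₂ * y₂) * X ^ d₂ + C (u₃ * y₃) * X ^ d₃ : ℝ[X]).support.card ≤ 3 :=
        (Finset.card_le_card (support_trinomial_subset d₁ d₂ d₃ (u₁ * y₁) (u₂ * y₂) (u₃ * y₃))).trans
          Finset.card_le_three
      omega
  omega


/-! ### Small tools -/

/-- The edge form only sees `y` through the products `y_iy_j`: flipping all three signs changes nothing. [folklore] -/
theorem edge09_form_neg (d₁ d₂ d₃ : ℕ) (q₀ b₁ b₂ b₃ y₁ y₂ y₃ : ℝ) :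
    (C q₀ + C b₁ * X ^ d₁ + C b₂ * X ^ d₂ + C b₃ * X ^ d₃
        - (C (-y₁) * X ^ d₁ + C (-y₂) * X ^ d₂ + C (-y₃) * X ^ d₃) ^ 2 : ℝ[X])
      = C q₀ + C b₁ * X ^ d₁ + C b₂ * X ^ d₂ + C b₃ * X ^ d₃
        - (C y₁ * X ^ d₁ + C y₂ * X ^ d₂ + C y₃ * X ^ d₃) ^ 2 := by
  simp only [map_neg]; ring

/-- A polynomial which is negative on `(0,∞)` has no positive root. [folklore] -/
theorem countP_posRoots_eq_zero_of_eval_neg (p : ℝ[X]) (h : ∀ x : ℝ, 0 < x → p.eval x < 0) :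
    p.roots.countP (fun x => 0 < x) = 0 := by
  classical
  rw [Multiset.countP_eq_zero]
  intro x hx hxpos
  rcases eq_or_ne p 0 with hp | hp
  · rw [hp, roots_zero] at hx; simp at hx
  · exact (h x hxpos).ne ((mem_roots hp).mp hx)

/-! ### The nine integer certificates -/

/-- **THEOREM O9, triple `(2,3,7)`**: for all real letters with `y₁ > 0 > y₂`, `y₃ > 0` (flip all three signs by
`edge09_form_neg`) the edge form `q₀ + b₁X^2 + b₂X^3 + b₃X^7 − (y₁X^2 + y₂X^3 + y₃X^7)²` has at most `8 < 9`
positive roots counted with multiplicity (certificate `u = (7,15,-208)`). [folklore] -/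
theorem countP_posRoots_zp_0_9_le_2_3_7 (q₀ b₁ b₂ b₃ y₁ y₂ y₃ : ℝ) (hy₁ : 0 < y₁) (hy₂ : y₂ < 0) (hy₃ : 0 < y₃) :
    ((C q₀ + C b₁ * X ^ 2 + C b₂ * X ^ 3 + C b₃ * X ^ 7
        - (C y₁ * X ^ 2 + C y₂ * X ^ 3 + C y₃ * X ^ 7) ^ 2 : ℝ[X]).roots.countP (fun x => 0 < x)) ≤ 8 := by
  have T := countP_posRoots_edge09_le_residual 2 3 7 q₀ b₁ b₂ b₃ y₁ y₂ y₃ (-24) (-60) (-72) 756 1680 12936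
    (by norm_num) (by norm_num) (by norm_num) (by norm_num) (by norm_num) (by norm_num)
  have S := countP_posRoots_quadform_le_four 2 3 7 (by norm_num) (by norm_num) (by norm_num) y₁ y₂ y₃ hy₁ hy₂ hy₃
    (-24) (-60) (-72) 756 1680 12936 7 15 (-208)
    25 (9 / 5) (-28) 72 (-(5 / 2)) 36150
    (by norm_num) (by norm_num) (by norm_num) (by norm_num) (by norm_num) (by norm_num) (by norm_num) (by norm_num)
    (by norm_num) (by norm_num) (by norm_num) (by norm_num) (by norm_num) (by norm_num) (by norm_num) (by norm_num)
  omega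

/-- **THEOREM O9, triple `(2,3,8)`**: for all real letters with `y₁ > 0 > y₂`, `y₃ > 0` (flip all three signs by
`edge09_form_neg`) the edge form `q₀ + b₁X^2 + b₂X^3 + b₃X^8 − (y₁X^2 + y₂X^3 + y₃X^8)²` has at most `8 < 9`
positive roots counted with multiplicity (certificate `u = (6,15,-186)`). [folklore] -/
theorem countP_posRoots_zp_0_9_le_2_3_8 (q₀ b₁ b₂ b₃ y₁ y₂ y₃ : ℝ) (hy₁ : 0 < y₁) (hy₂ : y₂ < 0) (hy₃ : 0 < y₃) :
    ((C q₀ + C b₁ * X ^ 2 + C b₂ * X ^ 3 + C b₃ * X ^ 8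
        - (C y₁ * X ^ 2 + C y₂ * X ^ 3 + C y₃ * X ^ 8) ^ 2 : ℝ[X]).roots.countP (fun x => 0 < x)) ≤ 8 := by
  have T := countP_posRoots_edge09_le_residual 2 3 8 q₀ b₁ b₂ b₃ y₁ y₂ y₃ (-32) (-90) (-144) 1120 2376 23296
    (by norm_num) (by norm_num) (by norm_num) (by norm_num) (by norm_num) (by norm_num)
  have S := countP_posRoots_quadform_le_four 2 3 8 (by norm_num) (by norm_num) (by norm_num) y₁ y₂ y₃ hy₁ hy₂ hy₃
    (-32) (-90) (-144) 1120 2376 23296 6 15 (-186)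
    4 0 1 81 (-(46 / 9)) 55772
    (by norm_num) (by norm_num) (by norm_num) (by norm_num) (by norm_num) (by norm_num) (by norm_num) (by norm_num)
    (by norm_num) (by norm_num) (by norm_num) (by norm_num) (by norm_num) (by norm_num) (by norm_num) (by norm_num)
  omega

/-- **THEOREM O9, triple `(2,3,9)`**: for all real letters with `y₁ > 0 > y₂`, `y₃ > 0` (flip all three signs by
`edge09_form_neg`) the edge form `q₀ + b₁X^2 + b₂X^3 + b₃X^9 − (y₁X^2 + y₂X^3 + y₃X^9)²` has at most `8 < 9`
positive roots counted with multiplicity (certificate `u = (11,33,-379)`). [folklore] -/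
theorem countP_posRoots_zp_0_9_le_2_3_9 (q₀ b₁ b₂ b₃ y₁ y₂ y₃ : ℝ) (hy₁ : 0 < y₁) (hy₂ : y₂ < 0) (hy₃ : 0 < y₃) :
    ((C q₀ + C b₁ * X ^ 2 + C b₂ * X ^ 3 + C b₃ * X ^ 9
        - (C y₁ * X ^ 2 + C y₂ * X ^ 3 + C y₃ * X ^ 9) ^ 2 : ℝ[X]).roots.countP (fun x => 0 < x)) ≤ 8 := by
  have T := countP_posRoots_edge09_le_residual 2 3 9 q₀ b₁ b₂ b₃ y₁ y₂ y₃ (-40) (-120) (-216) 1584 3240 38880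
    (by norm_num) (by norm_num) (by norm_num) (by norm_num) (by norm_num) (by norm_num)
  have S := countP_posRoots_quadform_le_four 2 3 9 (by norm_num) (by norm_num) (by norm_num) y₁ y₂ y₃ hy₁ hy₂ hy₃
    (-40) (-120) (-216) 1584 3240 38880 11 33 (-379)
    81 3 (-(2585 / 81)) 144 (-(21 / 2)) (6816020 / 81)
    (by norm_num) (by norm_num) (by norm_num) (by norm_num) (by norm_num) (by norm_num) (by norm_num) (by norm_num)
    (by norm_num) (by norm_num) (by norm_num) (by norm_num) (by norm_num) (by norm_num) (by norm_num) (by norm_num)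
  omega

/-- **THEOREM O9, triple `(2,3,10)`**: for all real letters with `y₁ > 0 > y₂`, `y₃ > 0` (flip all three signs by
`edge09_form_neg`) the edge form `q₀ + b₁X^2 + b₂X^3 + b₃X^10 − (y₁X^2 + y₂X^3 + y₃X^10)²` has at most `8 < 9`
positive roots counted with multiplicity (certificate `u = (11,33,-399)`). [folklore] -/
theorem countP_posRoots_zp_0_9_le_2_3_10 (q₀ b₁ b₂ b₃ y₁ y₂ y₃ : ℝ) (hy₁ : 0 < y₁) (hy₂ : y₂ < 0) (hy₃ : 0 < y₃) :
    ((C q₀ + C b₁ * X ^ 2 + C b₂ * X ^ 3 + C b₃ * X ^ 10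
        - (C y₁ * X ^ 2 + C y₂ * X ^ 3 + C y₃ * X ^ 10) ^ 2 : ℝ[X]).roots.countP (fun x => 0 < x)) ≤ 8 := by
  have T := countP_posRoots_edge09_le_residual 2 3 10 q₀ b₁ b₂ b₃ y₁ y₂ y₃ (-48) (-150) (-288) 2160 4290 61200
    (by norm_num) (by norm_num) (by norm_num) (by norm_num) (by norm_num) (by norm_num)
  have S := countP_posRoots_quadform_le_four 2 3 10 (by norm_num) (by norm_num) (by norm_num) y₁ y₂ y₃ hy₁ hy₂ hy₃
    (-48) (-150) (-288) 2160 4290 61200 11 33 (-399)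
    73 (213 / 73) (-(2229 / 73)) (13104 / 73) (-(14437 / 1092)) (11007791 / 91)
    (by norm_num) (by norm_num) (by norm_num) (by norm_num) (by norm_num) (by norm_num) (by norm_num) (by norm_num)
    (by norm_num) (by norm_num) (by norm_num) (by norm_num) (by norm_num) (by norm_num) (by norm_num) (by norm_num)
  omega

/-- **THEOREM O9, triple `(2,3,11)`**: for all real letters with `y₁ > 0 > y₂`, `y₃ > 0` (flip all three signs by
`edge09_form_neg`) the edge form `q₀ + b₁X^2 + b₂X^3 + b₃X^11 − (y₁X^2 + y₂X^3 + y₃X^11)²` has at most `8 < 9`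
positive roots counted with multiplicity (certificate `u = (8,21,-302)`). [folklore] -/
theorem countP_posRoots_zp_0_9_le_2_3_11 (q₀ b₁ b₂ b₃ y₁ y₂ y₃ : ℝ) (hy₁ : 0 < y₁) (hy₂ : y₂ < 0) (hy₃ : 0 < y₃) :
    ((C q₀ + C b₁ * X ^ 2 + C b₂ * X ^ 3 + C b₃ * X ^ 11
        - (C y₁ * X ^ 2 + C y₂ * X ^ 3 + C y₃ * X ^ 11) ^ 2 : ℝ[X]).roots.countP (fun x => 0 < x)) ≤ 8 := by
  have T := countP_posRoots_edge09_le_residual 2 3 11 q₀ b₁ b₂ b₃ y₁ y₂ y₃ (-56) (-180) (-360) 2860 5544 91960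
    (by norm_num) (by norm_num) (by norm_num) (by norm_num) (by norm_num) (by norm_num)
  have S := countP_posRoots_quadform_le_four 2 3 11 (by norm_num) (by norm_num) (by norm_num) y₁ y₂ y₃ hy₁ hy₂ hy₃
    (-56) (-180) (-360) 2860 5544 91960 8 21 (-302)
    8 (-(3 / 2)) (111 / 2) 63 (-(44 / 21)) (1107718 / 7)
    (by norm_num) (by norm_num) (by norm_num) (by norm_num) (by norm_num) (by norm_num) (by norm_num) (by norm_num)
    (by norm_num) (by norm_num) (by norm_num) (by norm_num) (by norm_num) (by norm_num) (by norm_num) (by norm_num)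
  omega

/-- **THEOREM O9, triple `(3,4,9)`**: for all real letters with `y₁ > 0 > y₂`, `y₃ > 0` (flip all three signs by
`edge09_form_neg`) the edge form `q₀ + b₁X^3 + b₂X^4 + b₃X^9 − (y₁X^3 + y₂X^4 + y₃X^9)²` has at most `8 < 9`
positive roots counted with multiplicity (certificate `u = (17,18,-405)`). [folklore] -/
theorem countP_posRoots_zp_0_9_le_3_4_9 (q₀ b₁ b₂ b₃ y₁ y₂ y₃ : ℝ) (hy₁ : 0 < y₁) (hy₂ : y₂ < 0) (hy₃ : 0 < y₃) :
    ((C q₀ + C b₁ * X ^ 3 + C b₂ * X ^ 4 + C b₃ * X ^ 9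
        - (C y₁ * X ^ 3 + C y₂ * X ^ 4 + C y₃ * X ^ 9) ^ 2 : ℝ[X]).roots.countP (fun x => 0 < x)) ≤ 8 := by
  have T := countP_posRoots_edge09_le_residual 3 4 9 q₀ b₁ b₂ b₃ y₁ y₂ y₃ (-108) (-168) (-160) 2592 4680 34020
    (by norm_num) (by norm_num) (by norm_num) (by norm_num) (by norm_num) (by norm_num)
  have S := countP_posRoots_quadform_le_four 3 4 9 (by norm_num) (by norm_num) (by norm_num) y₁ y₂ y₃ hy₁ hy₂ hy₃
    (-108) (-168) (-160) 2592 4680 34020 17 18 (-405)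
    181 (138 / 181) (-(4293 / 181)) (10640 / 181) (15003 / 1330) (59013684 / 665)
    (by norm_num) (by norm_num) (by norm_num) (by norm_num) (by norm_num) (by norm_num) (by norm_num) (by norm_num)
    (by norm_num) (by norm_num) (by norm_num) (by norm_num) (by norm_num) (by norm_num) (by norm_num) (by norm_num)
  omega

/-- **THEOREM O9, triple `(3,4,10)`**: for all real letters with `y₁ > 0 > y₂`, `y₃ > 0` (flip all three signs by
`edge09_form_neg`) the edge form `q₀ + b₁X^3 + b₂X^4 + b₃X^10 − (y₁X^3 + y₂X^4 + y₃X^10)²` has at most `8 < 9`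
positive roots counted with multiplicity (certificate `u = (15,20,-349)`). [folklore] -/
theorem countP_posRoots_zp_0_9_le_3_4_10 (q₀ b₁ b₂ b₃ y₁ y₂ y₃ : ℝ) (hy₁ : 0 < y₁) (hy₂ : y₂ < 0) (hy₃ : 0 < y₃) :
    ((C q₀ + C b₁ * X ^ 3 + C b₂ * X ^ 4 + C b₃ * X ^ 10
        - (C y₁ * X ^ 3 + C y₂ * X ^ 4 + C y₃ * X ^ 10) ^ 2 : ℝ[X]).roots.countP (fun x => 0 < x)) ≤ 8 := by
  have T := countP_posRoots_edge09_le_residual 3 4 10 q₀ b₁ b₂ b₃ y₁ y₂ y₃ (-144) (-252) (-320) 3510 6160 54400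
    (by norm_num) (by norm_num) (by norm_num) (by norm_num) (by norm_num) (by norm_num)
  have S := countP_posRoots_quadform_le_four 3 4 10 (by norm_num) (by norm_num) (by norm_num) y₁ y₂ y₃ hy₁ hy₂ hy₃
    (-144) (-252) (-320) 3510 6160 54400 15 20 (-349)
    81 (16 / 27) (-(575 / 27)) (464 / 9) (455 / 116) (4021479 / 29)
    (by norm_num) (by norm_num) (by norm_num) (by norm_num) (by norm_num) (by norm_num) (by norm_num) (by norm_num)
    (by norm_num) (by norm_num) (by norm_num) (by norm_num) (by norm_num) (by norm_num) (by norm_num) (by norm_num)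
  omega

/-- **THEOREM O9, triple `(3,4,11)`**: for all real letters with `y₁ > 0 > y₂`, `y₃ > 0` (flip all three signs by
`edge09_form_neg`) the edge form `q₀ + b₁X^3 + b₂X^4 + b₃X^11 − (y₁X^3 + y₂X^4 + y₃X^11)²` has at most `8 < 9`
positive roots counted with multiplicity (certificate `u = (18,32,-434)`). [folklore] -/
theorem countP_posRoots_zp_0_9_le_3_4_11 (q₀ b₁ b₂ b₃ y₁ y₂ y₃ : ℝ) (hy₁ : 0 < y₁) (hy₂ : y₂ < 0) (hy₃ : 0 < y₃) :
    ((C q₀ + C b₁ * X ^ 3 + C b₂ * X ^ 4 + C b₃ * X ^ 11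
        - (C y₁ * X ^ 3 + C y₂ * X ^ 4 + C y₃ * X ^ 11) ^ 2 : ℝ[X]).roots.countP (fun x => 0 < x)) ≤ 8 := by
  have T := countP_posRoots_edge09_le_residual 3 4 11 q₀ b₁ b₂ b₃ y₁ y₂ y₃ (-180) (-336) (-480) 4620 7920 82764
    (by norm_num) (by norm_num) (by norm_num) (by norm_num) (by norm_num) (by norm_num)
  have S := countP_posRoots_quadform_le_four 3 4 11 (by norm_num) (by norm_num) (by norm_num) y₁ y₂ y₃ hy₁ hy₂ hy₃
    (-180) (-336) (-480) 4620 7920 82764 18 32 (-434)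
    144 (5 / 3) (-(133 / 6)) 144 (-(9 / 2)) 197448
    (by norm_num) (by norm_num) (by norm_num) (by norm_num) (by norm_num) (by norm_num) (by norm_num) (by norm_num)
    (by norm_num) (by norm_num) (by norm_num) (by norm_num) (by norm_num) (by norm_num) (by norm_num) (by norm_num)
  omega

/-- **THEOREM O9, triple `(3,5,11)`**: for all real letters with `y₁ > 0 > y₂`, `y₃ > 0` (flip all three signs by
`edge09_form_neg`) the edge form `q₀ + b₁X^3 + b₂X^5 + b₃X^11 − (y₁X^3 + y₂X^5 + y₃X^11)²` has at most `8 < 9`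
positive roots counted with multiplicity (certificate `u = (12,33,-396)`). [folklore] -/
theorem countP_posRoots_zp_0_9_le_3_5_11 (q₀ b₁ b₂ b₃ y₁ y₂ y₃ : ℝ) (hy₁ : 0 < y₁) (hy₂ : y₂ < 0) (hy₃ : 0 < y₃) :
    ((C q₀ + C b₁ * X ^ 3 + C b₂ * X ^ 5 + C b₃ * X ^ 11
        - (C y₁ * X ^ 3 + C y₂ * X ^ 5 + C y₃ * X ^ 11) ^ 2 : ℝ[X]).roots.countP (fun x => 0 < x)) ≤ 8 := by
  have T := countP_posRoots_edge09_le_residual 3 5 11 q₀ b₁ b₂ b₃ y₁ y₂ y₃ (-90) (-360) (-350) 4158 11440 78166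
    (by norm_num) (by norm_num) (by norm_num) (by norm_num) (by norm_num) (by norm_num)
  have S := countP_posRoots_quadform_le_four 3 5 11 (by norm_num) (by norm_num) (by norm_num) y₁ y₂ y₃ hy₁ hy₂ hy₃
    (-90) (-360) (-350) 4158 11440 78166 12 33 (-396)
    54 (2 / 3) (-11) 715 (-(112 / 65)) (14711136 / 65)
    (by norm_num) (by norm_num) (by norm_num) (by norm_num) (by norm_num) (by norm_num) (by norm_num) (by norm_num)
    (by norm_num) (by norm_num) (by norm_num) (by norm_num) (by norm_num) (by norm_num) (by norm_num) (by norm_num)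
  omega

/-! ### The triple `(4,5,11)`: one more Euler twist at weight `17/2` -/

/-- **THEOREM O9, triple `(4,5,11)`**: for all real letters with `y₁ > 0 > y₂`, `y₃ > 0` the edge form
`q₀ + b₁X^4 + b₂X^5 + b₃X^11 − (y₁X^4 + y₂X^5 + y₃X^11)²` has at most `7 < 9` positive roots counted with multiplicity:
four Euler twists, a fifth at the real weight `17/2` (matrix `A'_{ij} = (d_i+d_j − 17/2)·m(d_i+d_j)`), then the split with
`u = (0, 36, −3450)` — `p = 36y₂X^5 − 3450y₃X^{11} < 0` on `(0,∞)` has no positive root. [folklore] -/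
theorem countP_posRoots_zp_0_9_le_4_5_11 (q₀ b₁ b₂ b₃ y₁ y₂ y₃ : ℝ) (hy₁ : 0 < y₁) (hy₂ : y₂ < 0) (hy₃ : 0 < y₃) :
    ((C q₀ + C b₁ * X ^ 4 + C b₂ * X ^ 5 + C b₃ * X ^ 11
        - (C y₁ * X ^ 4 + C y₂ * X ^ 5 + C y₃ * X ^ 11) ^ 2 : ℝ[X]).roots.countP (fun x => 0 < x)) ≤ 7 := by
  have T := countP_posRoots_edge09_le_residual 4 5 11 q₀ b₁ b₂ b₃ y₁ y₂ y₃ (-288) (-360) (-300) 6600 10560 74052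
    (by norm_num) (by norm_num) (by norm_num) (by norm_num) (by norm_num) (by norm_num)
  -- the fifth twist, at weight `17/2`
  have T5 := countP_posRoots_le_countP_posRoots_twist_succ
    (C ((-288) * y₁ ^ 2) * X ^ (2 * 4) + C (2 * (-360) * y₁ * y₂) * X ^ (4 + 5) + C ((-300) * y₂ ^ 2) * X ^ (2 * 5)
      + C (2 * 6600 * y₁ * y₃) * X ^ (4 + 11) + C (2 * 10560 * y₂ * y₃) * X ^ (5 + 11)
      + C (74052 * y₃ ^ 2) * X ^ (2 * 11) : ℝ[X]) (17 / 2)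
  rw [twist_sixnomial] at T5
  have hEq : (C ((-288) * y₁ ^ 2 * (((2 * 4 : ℕ) : ℝ) - 17 / 2)) * X ^ (2 * 4)
        + C (2 * (-360) * y₁ * y₂ * (((4 + 5 : ℕ) : ℝ) - 17 / 2)) * X ^ (4 + 5)
        + C ((-300) * y₂ ^ 2 * (((2 * 5 : ℕ) : ℝ) - 17 / 2)) * X ^ (2 * 5)
        + C (2 * 6600 * y₁ * y₃ * (((4 + 11 : ℕ) : ℝ) - 17 / 2)) * X ^ (4 + 11)
        + C (2 * 10560 * y₂ * y₃ * (((5 + 11 : ℕ) : ℝ) - 17 / 2)) * X ^ (5 + 11)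
        + C (74052 * y₃ ^ 2 * (((2 * 11 : ℕ) : ℝ) - 17 / 2)) * X ^ (2 * 11) : ℝ[X])
      = C (144 * y₁ ^ 2) * X ^ (2 * 4) + C (2 * (-180) * y₁ * y₂) * X ^ (4 + 5) + C ((-450) * y₂ ^ 2) * X ^ (2 * 5)
        + C (2 * 42900 * y₁ * y₃) * X ^ (4 + 11) + C (2 * 79200 * y₂ * y₃) * X ^ (5 + 11)
        + C (999702 * y₃ ^ 2) * X ^ (2 * 11) := by
    push_cast
    ring
  rw [hEq] at T5
  have S := countP_posRoots_quadform_le 4 5 11 (by norm_num) (by norm_num) (by norm_num) y₁ y₂ y₃ hy₁ hy₂ hy₃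
    144 (-180) (-450) 42900 79200 999702 0 36 (-3450)
    144 (-(5 / 4)) (3575 / 12) 621 (125 / 9) (5356 / 3)
    (by norm_num) (by norm_num) (by norm_num) (by norm_num) (by norm_num) (by norm_num) (by norm_num) (by norm_num)
    (by norm_num) (by norm_num) (by norm_num) (by norm_num) (by norm_num) (by norm_num) (by norm_num) (by norm_num)
  -- `p = 36y₂X^5 − 3450y₃X^11` has no positive root
  have hZp : ((C (0 * y₁) * X ^ 4 + C (36 * y₂) * X ^ 5 + C ((-3450) * y₃) * X ^ 11 : ℝ[X]).roots.countP
      (fun x => 0 < x)) = 0 := by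
    refine countP_posRoots_eq_zero_of_eval_neg _ fun x hx => ?_
    simp only [eval_add, eval_mul, eval_C, eval_pow, eval_X, zero_mul, zero_add]
    have h5 : 0 < x ^ 5 := pow_pos hx 5
    have h11 : 0 < x ^ 11 := pow_pos hx 11
    nlinarith [mul_pos (neg_pos.mpr hy₂) h5, mul_pos hy₃ h11]
  omega

end Summit.ValiantsHypothesis.ValiantsHypothesis.Theorems.LacunarySymmetroidMatrixDescartes.Census
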